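import Literature.AlgebraicGeometry.Resolution.RegularQuotientIdeal
import Mathlib.RingTheory.Smooth.Local
import Mathlib.RingTheory.Smooth.Locus
import Mathlib.RingTheory.Etale.Kaehler
import Mathlib.RingTheory.RegularLocalRing.Polynomial
import HarnessLib

/-!
# Regular with separable residue field ⇒ smooth, over a field (Stacks 00TV)

Topic: `Literature/AlgebraicGeometry/Resolution`. Converse companion of
`SmoothImpliesRegular.lean` (`isRegularLocalRing_of_isSmoothAt`: smooth over a field at a prime
⇒ the local ring is regular). We PROVE the classical partial converse (The Stacks Project,
Tag 00TV = Algebra, Lemma 10.140.5: "Let `k` be a field. Let `S` be a finite type `k`-algebra.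
Let `q ⊂ S` be a prime. Assume `κ(q)` is separable over `k`. The following are equivalent:
(1) The algebra `S` is smooth at `q` over `k`. (2) The ring `S_q` is regular."; direction
(2) ⇒ (1); cf. Matsumura, *Commutative Ring Theory*, Thm. 28.7 and EGA IV₄ 17.15.1/17.15.2):

* `isSmoothAt_of_isRegularLocalRing_of_formallySmooth_residueField` — for a finitely presented
  algebra `A` over a field `K` and a prime `q` such that `A_q` is a regular local ring and the
  residue field `κ(q)` is formally smooth over `K` (for a finitely generated field extension:
  separably generated, i.e. "separable" in the sense of EGA/Stacks), `A` is `K`-smooth at `q`.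

Proof. Present `A_q = P/I` with `P = K[X₁, …, X_n]_𝔓` (regular, formally smooth over `K`,
`Ω_{P/K}` finite free). Since `P/I ≅ A_q` is regular, `I = (f₁, …, f_c)` with `df₁, …, df_c`
linearly independent in `𝔪_P/𝔪_P²` (`exists_span_eq_of_isRegularLocalRing_quotient`,
`RegularQuotientIdeal.lean`, Matsumura 14.2). Formal smoothness of `κ = κ(q) = P/𝔪_P` over `K`
makes `𝔪_P/𝔪_P² → κ ⊗_P Ω_{P/K}` (split) injective (Mathlib's
`Algebra.FormallySmooth.iff_split_injection` for the surjection `P ↠ κ`), so the `dfᵢ` stay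
independent in `κ ⊗ Ω_{P/K}`, i.e. `κ ⊗ I → κ ⊗ Ω_{P/K}` is injective, which is Mathlib's
Jacobian criterion for formal smoothness of the local algebra `A_q`
(`Algebra.FormallySmooth.iff_injective_cotangentComplexBaseChange`).

The residue field hypothesis cannot be dropped (`K[t]` at `(t^p - a)`, `a ∉ K^p`, is smooth with
inseparable residue field, so the criterion is sufficient, not necessary), and regularity alone
does not imply smoothness over imperfect fields (`K[t]/(t^p - a)` is a field, hence regular, but
not geometrically reduced).

## Sources

* The Stacks Project, Tag 00TV (Algebra, Lemma 10.140.5).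
* H. Matsumura, *Commutative Ring Theory*, CUP 1986, Thm. 14.2 (via `RegularQuotientIdeal.lean`).

## What is used downstream

`InseparableLocalUniformizationEngineProofs.lean` (Temkin 2013, proof of Thm. 4.1.1, Step 4:
"In particular, `x₁` is `l`-smooth, and, replacing `l` with a purely inseparable extension, we
can also arrange that `x₁` is a simple `l`-smooth point"): after a finite purely inseparable
extension of the constant field making the residue field separable, regularity — which is
transported along smooth covers by EGA IV 17.5.8 (`Grothendieck1967_17_5_8_holds`) — is upgraded
to smoothness by this theorem.
-/

noncomputable section

namespace Literature.AlgebraicGeometry.Resolution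

universe u

open IsLocalRing Module TensorProduct KaehlerDifferential

/-- **Regular local ring with formally smooth residue field ⇒ smooth point** (The Stacks
Project, Tag 00TV, (2) ⇒ (1): for a finite type algebra `S` over a field `k` and a prime `q` with
`κ(q)/k` separable, `S_q` regular implies `S` smooth at `q`). Affine rendering: `A` finitely
presented over the field `K`, `q` a prime of `A` with `A_q` regular (`IsRegularLocalRing`) and
`κ(q) = A_q/qA_q` formally smooth over `K`; then `Algebra.IsSmoothAt K q` (`A_q` formally smooth
over `K`). [cite: StacksProject, Tag 00TV] -/
theorem isSmoothAt_of_isRegularLocalRing_of_formallySmooth_residueField (K A : Type u) [Field K]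
    [CommRing A] [Algebra K A] [Algebra.FinitePresentation K A] (q : Ideal A) [q.IsPrime]
    [hreg : IsRegularLocalRing (Localization.AtPrime q)]
    [h𝕜 : Algebra.FormallySmooth K (ResidueField (Localization.AtPrime q))] :
    Algebra.IsSmoothAt K q := by
  classical
  let S := Localization.AtPrime q
  -- a presentation `P = K[X]_𝔓 ↠ S = A_q`
  obtain ⟨n, f₀, hf₀⟩ := Algebra.FiniteType.iff_quotient_mvPolynomial''.mp
    (inferInstance : Algebra.FiniteType K A)
  let 𝔓 : Ideal (MvPolynomial (Fin n) K) := q.comap f₀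
  haveI : 𝔓.IsPrime := Ideal.comap_isPrime f₀ q
  let P := Localization.AtPrime 𝔓
  haveI : IsRegularLocalRing P := IsRegularRing.isRegularLocalRing_localization 𝔓
  let fP : P →ₐ[K] S := IsLocalization.liftAlgHom (M := 𝔓.primeCompl)
      (f := (IsScalarTower.toAlgHom K A S).comp f₀) fun x => by
    have hx : f₀ x.1 ∈ q.primeCompl := x.2
    simpa using IsLocalization.map_units (M := q.primeCompl) S ⟨f₀ x.1, hx⟩
  have hf₁ : Function.Surjective fP := by
    intro x
    obtain ⟨x, ⟨s, hs⟩, rfl⟩ := IsLocalization.exists_mk'_eq q.primeCompl x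
    obtain ⟨x, rfl⟩ := hf₀ x
    obtain ⟨s, rfl⟩ := hf₀ s
    refine ⟨IsLocalization.mk' (M := 𝔓.primeCompl) P x ⟨s, hs⟩, ?_⟩
    simp [fP, IsLocalization.lift_mk', Units.mul_inv_eq_iff_eq_mul, IsUnit.liftRight]
  algebraize [fP.toRingHom]
  haveI : IsScalarTower K P S := IsScalarTower.of_algebraMap_eq fun c => (fP.commutes c).symm
  have hf₂ : (RingHom.ker (algebraMap P S)).FG := IsNoetherian.noetherian _
  haveI : Algebra.FormallyEtale (MvPolynomial (Fin n) K) P := .of_isLocalization 𝔓.primeCompl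
  haveI : Algebra.FormallySmooth K P := .comp _ (MvPolynomial (Fin n) K) _
  haveI : Module.Free P Ω[P⁄K] :=
    .of_equiv (KaehlerDifferential.tensorKaehlerEquivOfFormallyEtale K (MvPolynomial (Fin n) K) P)
  haveI : Module.Finite P Ω[P⁄K] :=
    Module.Finite.equiv
      (KaehlerDifferential.tensorKaehlerEquivOfFormallyEtale K (MvPolynomial (Fin n) K) P)
  -- the ideal `I` of the presentation lies in the maximal ideal; `P → S` is local
  set I : Ideal P := RingHom.ker (algebraMap P S) with hI
  have hf₁' : Function.Surjective (algebraMap P S) := hf₁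
  have hmemP : ∀ x : P, algebraMap P S x ∈ maximalIdeal S → x ∈ maximalIdeal P := by
    intro x hx
    by_contra hxm
    have hxu : IsUnit x := not_not.mp fun h => hxm ((IsLocalRing.mem_maximalIdeal x).mpr h)
    exact (IsLocalRing.mem_maximalIdeal _).mp hx (hxu.map _)
  have hIm : I ≤ maximalIdeal P := fun x hx =>
    hmemP x (by rw [RingHom.mem_ker.mp hx]; exact zero_mem _)
  have hmapm : ∀ x : P, x ∈ maximalIdeal P → algebraMap P S x ∈ maximalIdeal S := by
    intro x hx
    by_contra hxS
    have hu : IsUnit (algebraMap P S x) :=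
      not_not.mp fun h => hxS ((IsLocalRing.mem_maximalIdeal _).mpr h)
    obtain ⟨y, hy⟩ := hf₁' (↑(hu.unit⁻¹) : S)
    have h1 : x * y - 1 ∈ I := by
      rw [hI, RingHom.mem_ker, map_sub, map_mul, hy, map_one, IsUnit.mul_val_inv, sub_self]
    have h2 : x * y ∈ maximalIdeal P := Ideal.mul_mem_right _ _ hx
    have h3 : (1 : P) ∈ maximalIdeal P := by
      have := Ideal.sub_mem _ h2 (hIm h1)
      rwa [sub_sub_cancel] at this
    exact (IsLocalRing.maximalIdeal.isMaximal P).ne_top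
      (Ideal.eq_top_of_isUnit_mem _ h3 isUnit_one)
  -- the residue field `𝕜 = κ(q)` of `S` as a `P`-algebra; its kernel is `𝔪_P`
  let 𝕜 := ResidueField S
  -- (`𝕜` is a `P`-algebra through `S`, by `Ideal.Quotient.algebra`)
  have hPk : ∀ x : P, algebraMap P 𝕜 x = algebraMap S 𝕜 (algebraMap P S x) := fun x =>
    IsScalarTower.algebraMap_apply P S 𝕜 x
  haveI : IsScalarTower K P 𝕜 := IsScalarTower.of_algebraMap_eq fun c => by
    rw [hPk, ← IsScalarTower.algebraMap_apply K P S, ← IsScalarTower.algebraMap_apply K S 𝕜]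
  have h₃ : maximalIdeal S ≤ RingHom.ker (algebraMap S 𝕜) := fun y hy => by
    rw [RingHom.mem_ker]
    exact (residue_eq_zero_iff y).mpr hy
  have hsurj𝕜 : Function.Surjective (algebraMap P 𝕜) := by
    rw [IsScalarTower.algebraMap_eq P S 𝕜]
    exact (residue_surjective (R := S)).comp hf₁'
  have hJ : RingHom.ker (algebraMap P 𝕜) = maximalIdeal P := by
    ext x
    rw [RingHom.mem_ker, hPk]
    change residue S (algebraMap P S x) = 0 ↔ _
    rw [residue_eq_zero_iff]
    exact ⟨hmemP x, hmapm x⟩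
  -- formal smoothness of `𝕜` over `K`: `𝔪_P/𝔪_P² → 𝕜 ⊗ Ω_{P/K}` is injective
  have hinjJ : Function.Injective (kerCotangentToTensor K P 𝕜) := by
    obtain ⟨l, hl⟩ := (Algebra.FormallySmooth.iff_split_injection hsurj𝕜).mp h𝕜
    refine Function.LeftInverse.injective (g := l) fun x => ?_
    exact LinearMap.congr_fun hl x
  -- `S ≅ P/I` regular ⇒ `I = (f₁, …, f_c)` with linearly independent differentials
  haveI : IsRegularLocalRing (P ⧸ I) :=
    IsRegularLocalRing.of_ringEquiv (RingHom.quotientKerEquivOfSurjective hf₁').symm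
  obtain ⟨c, f, hfI, hspan, hli⟩ :=
    exists_span_eq_of_isRegularLocalRing_quotient (R := P) (J := I) hIm (I : Set P) (Ideal.span_eq I)
  have hf' : ∀ i, f i ∈ maximalIdeal P := fun i => hIm (hfI i)
  -- the Jacobian criterion
  refine (Algebra.FormallySmooth.iff_injective_cotangentComplexBaseChange (R := K) (S := S) P 𝕜
    hf₁' hf₂ h₃).mpr ?_
  -- every element of `𝕜 ⊗ I` is `1 ⊗ g`
  have htmul : ∀ z : 𝕜 ⊗[P] I, ∃ g : I, z = (1 : 𝕜) ⊗ₜ[P] g := by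
    intro z
    induction z using TensorProduct.induction_on with
    | zero => exact ⟨0, by rw [tmul_zero]⟩
    | tmul a x =>
      obtain ⟨p, rfl⟩ := hsurj𝕜 a
      refine ⟨p • x, ?_⟩
      rw [tmul_smul, smul_tmul', Algebra.algebraMap_eq_smul_one]
    | add z₁ z₂ h₁ h₂ =>
      obtain ⟨g₁, rfl⟩ := h₁
      obtain ⟨g₂, rfl⟩ := h₂
      exact ⟨g₁ + g₂, by rw [tmul_add]⟩
  rw [injective_iff_map_eq_zero]
  intro z hz
  obtain ⟨g, rfl⟩ := htmul z
  -- `g = ∑ pᵢ fᵢ`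
  have hgspan : (g : P) ∈ Ideal.span (Set.range f) := by rw [hspan]; exact g.2
  obtain ⟨p, hp⟩ := Ideal.mem_span_range_iff_exists_fun.mp hgspan
  -- the image of `1 ⊗ g` is `1 ⊗ dg`
  have himg : cotangentComplexBaseChange K S P 𝕜 ((1 : 𝕜) ⊗ₜ[P] g) =
      (1 : 𝕜) ⊗ₜ[P] D K P (g : P) := by
    rw [cotangentComplexBaseChange_tmul, one_smul, kerToTensor_apply]
  rw [himg] at hz
  -- hence `g ∈ 𝔪_P²`
  have hgJ : (g : P) ∈ RingHom.ker (algebraMap P 𝕜) := by rw [hJ]; exact hIm g.2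
  have hg2 : (g : P) ∈ (maximalIdeal P) ^ 2 := by
    have h1 : kerCotangentToTensor K P 𝕜
        ((RingHom.ker (algebraMap P 𝕜)).toCotangent ⟨g, hgJ⟩) = 0 := by
      rw [kerCotangentToTensor_toCotangent]
      exact hz
    have h2 : (RingHom.ker (algebraMap P 𝕜)).toCotangent ⟨g, hgJ⟩ = 0 :=
      hinjJ (h1.trans (map_zero _).symm)
    have h3 : (g : P) ∈ RingHom.ker (algebraMap P 𝕜) ^ 2 := (Ideal.toCotangent_eq_zero _ _).mp h2
    rwa [hJ] at h3
  -- independence of the `dfᵢ` in `𝔪_P/𝔪_P²` forces `pᵢ ∈ 𝔪_P`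
  have hpi : ∀ i, p i ∈ maximalIdeal P := by
    intro i
    have hsum : (maximalIdeal P).toCotangent
        (∑ j, p j • (⟨f j, hf' j⟩ : maximalIdeal P)) = 0 := by
      rw [Ideal.toCotangent_eq_zero]
      have hcoe : (((∑ j, p j • (⟨f j, hf' j⟩ : maximalIdeal P)) : maximalIdeal P) : P) =
          ∑ j, p j * f j := by
        rw [AddSubmonoidClass.coe_finsetSum]
        refine Finset.sum_congr rfl fun j _ => ?_
        rfl
      rw [hcoe, hp]
      exact hg2
    rw [map_sum] at hsum
    have hsum' : (∑ j, residue P (p j) • (maximalIdeal P).toCotangent ⟨f j, hf' j⟩) = 0 := by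
      rw [← hsum]
      refine Finset.sum_congr rfl fun j _ => ?_
      rw [LinearMap.map_smul_of_tower]
      rfl
    have := Fintype.linearIndependent_iff.mp hli (fun j => residue P (p j)) hsum' i
    exact (residue_eq_zero_iff _).mp this
  -- conclude `1 ⊗ g = ∑ p̄ᵢ ⊗ fᵢ = 0`
  have hgsum : g = ∑ i, p i • (⟨f i, hfI i⟩ : I) := by
    apply Subtype.ext
    rw [AddSubmonoidClass.coe_finsetSum, ← hp]
    refine Finset.sum_congr rfl fun j _ => ?_
    rfl
  rw [hgsum, tmul_sum]
  refine Finset.sum_eq_zero fun i _ => ?_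
  rw [tmul_smul, smul_tmul', ← Algebra.algebraMap_eq_smul_one]
  have hzero : algebraMap P 𝕜 (p i) = 0 := by
    rw [← RingHom.mem_ker, hJ]
    exact hpi i
  rw [hzero, zero_tmul]

end Literature.AlgebraicGeometry.Resolution

end
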